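import Summits.NavierStokesRegularity.NavierStokesRegularity.Theorems.TypeIIInviscidRelaxationAxisymSwirlRegularZhangBarrierRiccatiW
import Summits.NavierStokesRegularity.NavierStokesRegularity.Theorems.TypeIIInviscidRelaxationAxisymSwirlRegularZhangBarrierRiccatiKappaCalc
import HarnessLib

/-!
# Toward the κ-inflow barriers, `κ ∈ (0,1]`: the elementary tail `φ_W` and its Riccati inequality

Helper toward the crux `AxisymSwirlRegular` (stmt-NavierStokesRegularity-1964, route TypeIIInviscidRelaxation),
registered line `radial_inflow_split`, criterion side (⟨19059⟩); continuation of `…ZhangBarrierRiccatiW`.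

THIS FILE instantiates `ZhangBarrier.riccati_abstractW` on the concrete functions of the ELEMENTARY κ-recipe
(`0 < κ ≤ 1`, `M > 0`; `hK κ M ξ = (M/κ)ξ^κ` from `…RiccatiKappaCalc`):
`W(ξ) = ξ^{2−κ} − 2M`, `A_W = 8(1+2M)² e^{M(1+2M)/κ} + 1/(16κ)`, `m_W = 1/(32(A_W+2)(1+2M))` (so `2m_W ≤ κ`),
`φ_W = A_W ξ^{κ−1} e^{−h} + 2ξ^{1−κ}/√(1+W²)` — whose primitive `−(A_W/M)e^{−h} + (2/(2−κ)) arsinh W` is elementary —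
`φ_W′` in closed form (`hasDerivAt_phiW`, `ξ > 0`), and **`riccati_le_W`**:
`φ_W′ + (Mξ^{κ−1} − 1/ξ − ξ/2)φ_W + m_W φ_W² ≤ −1` on `(0,∞)`.

Pure Mathlib real analysis; no NS statement here. [new]
-/

noncomputable section

set_option linter.dupNamespace false

open Set Real

namespace Summit.NavierStokesRegularity.NavierStokesRegularity.Theorems.ZhangBarrier

/-- Amplitude `A_W = 8(1+2M)² e^{M(1+2M)/κ} + 1/(16κ)`. [new] -/
def bigAW (κ M : ℝ) : ℝ := 8 * (1 + 2 * M) ^ 2 * exp (M * (1 + 2 * M) / κ) + 1 / (16 * κ)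

/-- Exponent `m_W = 1/(32(A_W+2)(1+2M))`. [new] -/
def expoW (κ M : ℝ) : ℝ := 1 / (32 * (bigAW κ M + 2) * (1 + 2 * M))

/-- `W(ξ) = ξ^{2−κ} − 2M`. [new] -/
def WK (κ M ξ : ℝ) : ℝ := ξ ^ (2 - κ) - 2 * M

/-- The elementary tail `φ_W = A_W ξ^{κ−1} e^{−h} + 2 ξ^{1−κ}/√(1+W²)`. [new] -/
def phiW (κ M ξ : ℝ) : ℝ :=
  bigAW κ M * ξ ^ (κ - 1) * exp (-hK κ M ξ) + 2 * ξ ^ (1 - κ) / √(1 + WK κ M ξ ^ 2)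

/-- `φ_W′` in closed form. [new] -/
def dphiW (κ M ξ : ℝ) : ℝ :=
  bigAW κ M * exp (-hK κ M ξ) * ((κ - 1) * ξ ^ (κ - 2) - M * ξ ^ (κ - 1) * ξ ^ (κ - 1))
    + 2 * (1 - κ) * ξ ^ (-κ) / √(1 + WK κ M ξ ^ 2)
    - 2 * ξ ^ (1 - κ) * (WK κ M ξ * ((2 - κ) * ξ ^ (1 - κ))) / √(1 + WK κ M ξ ^ 2) ^ 3

/-- `A_W > 0`. -/
theorem bigAW_pos {κ : ℝ} (hκ : 0 < κ) (M : ℝ) : 0 < bigAW κ M := by unfold bigAW; positivity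

/-- `m_W > 0`. -/
theorem expoW_pos {κ M : ℝ} (hκ : 0 < κ) (hM : 0 < M) : 0 < expoW κ M := by
  unfold expoW; have := bigAW_pos hκ M; positivity

/-- `32(A_W+2)(1+2M) m_W = 1`. -/
theorem expoW_mul {κ M : ℝ} (hκ : 0 < κ) (hM : 0 < M) :
    32 * (bigAW κ M + 2) * (1 + 2 * M) * expoW κ M = 1 := by
  unfold expoW; have := bigAW_pos hκ M; field_simp

/-- `2 m_W ≤ κ` (the reason for the term `1/(16κ)` in `A_W`). -/
theorem two_expoW_le {κ M : ℝ} (hκ : 0 < κ) (hM : 0 < M) : 2 * expoW κ M ≤ κ := by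
  have hA : 1 / (16 * κ) ≤ bigAW κ M := by
    unfold bigAW; have : 0 ≤ 8 * (1 + 2 * M) ^ 2 * exp (M * (1 + 2 * M) / κ) := by positivity
    linarith
  have hA0 := bigAW_pos hκ M
  unfold expoW
  rw [show 2 * (1 / (32 * (bigAW κ M + 2) * (1 + 2 * M))) = 1 / (16 * ((bigAW κ M + 2) * (1 + 2 * M))) by
    field_simp; ring]
  rw [div_le_iff₀ (by positivity)]
  have h1 : 1 ≤ 16 * κ * bigAW κ M := by
    rw [div_le_iff₀ (by positivity)] at hA; linarith
  nlinarith

/-- `W′ = (2−κ) ξ^{1−κ}` on `ξ > 0`. -/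
theorem hasDerivAt_WK {κ M ξ : ℝ} (hξ : 0 < ξ) :
    HasDerivAt (WK κ M) ((2 - κ) * ξ ^ (1 - κ)) ξ := by
  have h := (hasDerivAt_rpow_const (p := 2 - κ) (Or.inl hξ.ne')).sub_const (2 * M)
  refine h.congr_deriv ?_
  rw [show 2 - κ - 1 = 1 - κ by ring]

/-- `φ_W′ = dphiW` on `ξ > 0`. -/
theorem hasDerivAt_phiW {κ M ξ : ℝ} (hκ : κ ≠ 0) (hξ : 0 < ξ) :
    HasDerivAt (phiW κ M) (dphiW κ M ξ) ξ := by
  have hh := hasDerivAt_hK (M := M) hκ hξ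
  have h1a : HasDerivAt (fun x => x ^ (κ - 1)) ((κ - 1) * ξ ^ (κ - 1 - 1)) ξ :=
    hasDerivAt_rpow_const (Or.inl hξ.ne')
  have h1 := ((h1a.mul hh.neg.exp).const_mul (bigAW κ M))
  have hpos : 1 + WK κ M ξ ^ 2 ≠ 0 := by positivity
  have hsq : √(1 + WK κ M ξ ^ 2) ≠ 0 := by positivity
  have h2 : HasDerivAt (fun x => 1 + WK κ M x ^ 2) (((2 : ℕ) : ℝ) * WK κ M ξ ^ (2 - 1) * ((2 - κ) * ξ ^ (1 - κ))) ξ :=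
    ((hasDerivAt_WK (κ := κ) (M := M) hξ).pow 2).const_add 1
  have h3 := h2.sqrt hpos
  have h4a : HasDerivAt (fun x => 2 * x ^ (1 - κ)) (2 * ((1 - κ) * ξ ^ (1 - κ - 1))) ξ :=
    (hasDerivAt_rpow_const (Or.inl hξ.ne')).const_mul 2
  have h4 := h4a.fun_div h3 hsq
  have h : HasDerivAt (fun x => bigAW κ M * (x ^ (κ - 1) * exp (-hK κ M x)) + 2 * x ^ (1 - κ) / √(1 + WK κ M x ^ 2))
      (bigAW κ M * ((κ - 1) * ξ ^ (κ - 1 - 1) * exp (-hK κ M ξ) + ξ ^ (κ - 1) * (exp (-hK κ M ξ) * -(M * ξ ^ (κ - 1))))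
        + (2 * ((1 - κ) * ξ ^ (1 - κ - 1)) * √(1 + WK κ M ξ ^ 2)
            - 2 * ξ ^ (1 - κ) * (((2 : ℕ) : ℝ) * WK κ M ξ ^ (2 - 1) * ((2 - κ) * ξ ^ (1 - κ))
              / (2 * √(1 + WK κ M ξ ^ 2)))) / √(1 + WK κ M ξ ^ 2) ^ 2) ξ :=
    h1.add h4
  have hfun : (fun x => bigAW κ M * (x ^ (κ - 1) * exp (-hK κ M x)) + 2 * x ^ (1 - κ) / √(1 + WK κ M x ^ 2))
      = phiW κ M := by
    funext x; simp only [phiW]; ring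
  rw [hfun] at h
  refine h.congr_deriv ?_
  rw [show κ - 1 - 1 = κ - 2 by ring, show 1 - κ - 1 = -κ by ring]
  simp only [dphiW]
  norm_num
  field_simp
  ring

/-- On `W < 1`: `ξ^κ ≤ 1 + 2M`, hence `A_W e^{−h} ≥ 8(1+2M)²`. -/
theorem QW_ge {κ M ξ : ℝ} (hκ0 : 0 < κ) (hκ1 : κ ≤ 1) (hM : 0 < M) (hξ : 0 < ξ) (hW : WK κ M ξ < 1) :
    8 * (1 + 2 * M) ^ 2 ≤ bigAW κ M * exp (-hK κ M ξ) := by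
  have hpow : ξ ^ κ ≤ 1 + 2 * M := by
    rcases le_or_gt ξ 1 with h1 | h1
    · have := rpow_le_one hξ.le h1 hκ0.le; linarith
    · have hk : ξ ^ κ ≤ ξ ^ (2 - κ) := rpow_le_rpow_of_exponent_le h1.le (by linarith)
      unfold WK at hW; linarith
  have hh : hK κ M ξ ≤ M * (1 + 2 * M) / κ := by
    unfold hK
    rw [div_mul_eq_mul_div, div_le_div_iff_of_pos_right hκ0]
    exact mul_le_mul_of_nonneg_left hpow hM.le
  have hE : exp (-(M * (1 + 2 * M) / κ)) ≤ exp (-hK κ M ξ) := exp_le_exp.2 (by linarith)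
  have hA : 8 * (1 + 2 * M) ^ 2 * exp (M * (1 + 2 * M) / κ) ≤ bigAW κ M := by
    unfold bigAW; have : 0 ≤ 1 / (16 * κ) := by positivity
    linarith
  have hprod : 8 * (1 + 2 * M) ^ 2 * exp (M * (1 + 2 * M) / κ) * exp (-(M * (1 + 2 * M) / κ))
      = 8 * (1 + 2 * M) ^ 2 := by
    rw [mul_assoc, ← exp_add, add_neg_cancel, exp_zero, mul_one]
  calc 8 * (1 + 2 * M) ^ 2
      = 8 * (1 + 2 * M) ^ 2 * exp (M * (1 + 2 * M) / κ) * exp (-(M * (1 + 2 * M) / κ)) := hprod.symm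
    _ ≤ bigAW κ M * exp (-(M * (1 + 2 * M) / κ)) := by gcongr
    _ ≤ bigAW κ M * exp (-hK κ M ξ) := by
        exact mul_le_mul_of_nonneg_left hE (bigAW_pos hκ0 M).le

/-- **The Riccati inequality of the elementary κ-tail**: for `0 < κ ≤ 1`, `M > 0`, `ξ > 0`,
`φ_W′ + (Mξ^{κ−1} − 1/ξ − ξ/2)φ_W + m_W φ_W² ≤ −1`. [new] -/
theorem riccati_le_W {κ M ξ : ℝ} (hκ0 : 0 < κ) (hκ1 : κ ≤ 1) (hM : 0 < M) (hξ : 0 < ξ) :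
    dphiW κ M ξ + (M * ξ ^ (κ - 1) - ξ⁻¹ - ξ / 2) * phiW κ M ξ + expoW κ M * phiW κ M ξ ^ 2 ≤ -1 := by
  set A := bigAW κ M with hA_def
  set m := expoW κ M with hm_def
  set ρ := ξ ^ (1 - κ) with hρ_def
  set W := WK κ M ξ with hW_def
  set Q := bigAW κ M * exp (-hK κ M ξ) with hQ_def
  set S := √(1 + WK κ M ξ ^ 2) with hS_def
  have hρ : 0 < ρ := rpow_pos_of_pos hξ _
  have hA : 0 < A := bigAW_pos hκ0 M
  have hQ0 : 0 < Q := by rw [hQ_def]; positivity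
  have hQA : Q ≤ A := by
    rw [hQ_def, hA_def]
    have hh : 0 ≤ hK κ M ξ := by unfold hK; positivity
    have : exp (-hK κ M ξ) ≤ 1 := by rw [exp_le_one_iff]; linarith
    have hA' := bigAW_pos hκ0 M
    nlinarith
  have hS0 : 0 < S := by rw [hS_def]; positivity
  have hSW : S ^ 2 = 1 + W ^ 2 := by rw [hS_def, hW_def, sq_sqrt (by positivity)]
  -- rpow bookkeeping in the atom `ρ = ξ^{1−κ}`
  have hρinv : ξ ^ (κ - 1) = ρ⁻¹ := by
    rw [hρ_def, ← rpow_neg hξ.le, show -(1 - κ) = κ - 1 by ring]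
  have hκ2 : ξ ^ (κ - 2) = ρ⁻¹ * ξ⁻¹ := by
    rw [show κ - 2 = κ - 1 - 1 by ring, rpow_sub_one hξ.ne', hρinv, div_eq_mul_inv]
  have hmk : ξ ^ (-κ) = ρ * ξ⁻¹ := by
    rw [show -κ = 1 - κ - 1 by ring, rpow_sub_one hξ.ne', div_eq_mul_inv]
  have hWρ : W = ξ * ρ - 2 * M := by
    rw [hW_def]; unfold WK
    rw [show 2 - κ = 1 + (1 - κ) by ring, rpow_add hξ, rpow_one]
  have hρa : 1 ≤ ξ → 1 ≤ ρ ∧ ρ ≤ ξ := fun h1 =>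
    ⟨one_le_rpow h1 (by linarith), by
      have := rpow_le_rpow_of_exponent_le h1 (show 1 - κ ≤ 1 by linarith)
      rwa [rpow_one] at this⟩
  have hρb : ξ ≤ 1 → ξ ≤ ρ ∧ ρ ≤ 1 := fun h1 =>
    ⟨by
      have := rpow_le_rpow_of_exponent_ge hξ h1 (show 1 - κ ≤ 1 by linarith)
      rwa [rpow_one] at this, rpow_le_one hξ.le h1 (by linarith)⟩
  have key := riccati_abstractW hξ hκ0 hκ1 hM hρ hρa hρb hWρ hS0 hSW hQ0 hQA (expoW_pos hκ0 hM)
    (expoW_mul hκ0 hM) (fun hW1 => QW_ge hκ0 hκ1 hM hξ hW1)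
  have hphi : phiW κ M ξ = Q / ρ + 2 * ρ / S := by
    simp only [phiW, ← hS_def]
    simp only [← hρ_def, hρinv, hQ_def]
    ring
  have hdphi : dphiW κ M ξ = Q * ((κ - 1) * (ρ⁻¹ * ξ⁻¹) - M * ρ⁻¹ * ρ⁻¹)
      + 2 * (1 - κ) * (ρ * ξ⁻¹) / S - 2 * ρ * (W * ((2 - κ) * ρ)) / S ^ 3 := by
    simp only [dphiW, ← hS_def]
    simp only [← hW_def, ← hρ_def, hρinv, hκ2, hmk, ← hQ_def]
  have hE : M * ξ ^ (κ - 1) = M * ρ⁻¹ := by rw [hρinv]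
  have expand : dphiW κ M ξ + (M * ξ ^ (κ - 1) - ξ⁻¹ - ξ / 2) * phiW κ M ξ + m * phiW κ M ξ ^ 2
      = -(Q / ρ * ((2 - κ) / ξ + ξ / 2)) - W / S - 2 * κ * ρ / (ξ * S)
          - 2 * (2 - κ) * ρ ^ 2 * W / S ^ 3 + m * (Q / ρ + 2 * ρ / S) ^ 2 := by
    rw [hphi, hdphi, hE, hWρ]
    field_simp
    ring
  rw [expand]
  exact key

end Summit.NavierStokesRegularity.NavierStokesRegularity.Theorems.ZhangBarrier

end
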